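import Literature.NumberTheory.EllipticCurves.Fisher2012.HesseFamilyThreeReverse
import HarnessLib

/-!
# Fisher 2012, §8, case `n = 3`: the Hesse covariants `𝔠₄(λ,μ)`, `𝔠₆(λ,μ)` in CLOSED FORM (PROVED)

THEOREMS ONLY (0 definitions of notions, 0 named facts): the closed forms of the two covariants that
`Fisher2012/HesseFamilyFiveCongruence.lean` (§"Appendix: the case `n = 3` of Theorem 13.2", x11a gen 11)
DEFINES from Fisher's quartic `𝔇(λ,μ) = λ⁴ − 6c₄λ²μ² − 8c₆λμ³ − 3c₄²μ⁴` by the printed Hessian /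
Jacobian determinants (`hesseC4three = −|H(𝔇)|/(4²·3²)`, `hesseC6three = |J(𝔇, 𝔠₄)|/(4·4)`, via
`MvPolynomial.pderiv`), namely

* `𝔠₄(λ,μ) = c₄λ⁴ + 4c₆λ³μ + 6c₄²λ²μ² + 4c₄c₆λμ³ + (4c₆² − 3c₄³)μ⁴` (`hesseC4three_eq`; evaluated form `eval_hesseC4three` in cc-eng-2's file),
* `𝔠₆(λ,μ) = c₆λ⁶ + 6c₄²λ⁵μ + 15c₄c₆λ⁴μ² + 20c₆²λ³μ³ + 15c₄²c₆λ²μ⁴ + (18c₄⁴ − 12c₄c₆²)λμ⁵ + (9c₄³c₆ − 8c₆³)μ⁶`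
  (`hesseC6three_eq`; evaluated form `eval_hesseC6three` in cc-eng-2's file),

the syzygy `𝔠₄³ − 𝔠₆² = (c₄³ − c₆²)·𝔇³` (Fisher 2012 §8: "The Hesse polynomials are related by
`𝔠₄(λ,μ)³ − 𝔠₆(λ,μ)² = (c₄³ − c₆²)𝔇(λ,μ)ⁿ`", here `n = 3`; `hesseSyzygy_three`), the member
`E_{λ,μ} = ⟨0, 0, 0, −27𝔠₄(λ,μ), −54𝔠₆(λ,μ)⟩` of the pencil with its coefficients in closed form
(`hessePencil3_eq`), its discriminant `Δ(E_{λ,μ}) = 2⁶·3⁹·(c₄³ − c₆²)·𝔇(λ,μ)³` (`Δ_hessePencil3`), and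
"`E_{λ,μ}` is non-singular iff `𝔇(λ,μ) ≠ 0`" when `c₄³ ≠ c₆²` (`isElliptic_hessePencil3_iff`). These are the
formulae "already known to Salmon" (Fisher 2012 §1) and make a member of the `n = 3` Hesse pencil a
`norm_num`-decidable object: USE (cell `b2b-bsdres`, HOME `run/shared/lean/b2b/bsd-rank1-residual/`,
instrument B-10 v0.4 `X3E` of cc-eng-2, report `class-closure/eng-2/X3E-1.md`): a certified
`3`-congruence `W[3] ≅ G[3]` is a rational point `(λ:μ)` with `G ≅_ℚ E_{λ,μ}`; with the closed forms the
`ℚ`-isomorphism is an identity of five rational numbers, so — modulo the one published binder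
`thm132_threeCongruent_hessePencil` (Fisher 2012 Thm. 13.2, `n = 3`) — every such row is a kernel
certificate (`Summits/BirchSwinnertonDyer/Rank1Residual/O5/ThreeCongruenceHesseCertificate.lean`).
HONEST FRAMING of that cell applies to the use, not to this file: nothing here mentions a residual class.

DEDUP NOTE (cc-typer-5 GEN 5, same day, whole-file resubmission): the first landing of this file (p279760,
14:14Z) and cc-eng-2's `Fisher2012/HesseFamilyThreeReverse.lean` (p279664, 14:12Z) were verified concurrently
against trees that did not yet contain each other and BOTH declared `Fisher2012.pderiv_zero_hesseD3`,
`pderiv_one_hesseD3`, `eval_hesseD3`, `eval_hesseC4three`, `eval_hesseC6three` (character-identical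
statements) — a clash for every module importing both (the `Literature` umbrella first). This resubmission
REMOVES those five from this file and IMPORTS cc-eng-2's file for them (theirs are the declarations of
record); every other declaration below is unchanged byte-for-byte.

References: [cite: Fisher2012Hessian, §8 (Hesse polynomials, n = 3; the displays defining 𝔠₄, 𝔠₆ and the
relation 𝔠₄³ − 𝔠₆² = (c₄³ − c₆²)𝔇ⁿ) and §1 ("our formulae in the case n = 3 were already known to Salmon")]
[cite: SilvermanAEC2009, III §1 (Δ = (c₄³ − c₆²)/1728)]
-/

noncomputable section

open MvPolynomial WeierstrassCurve

namespace Literature.NumberTheory.EllipticCurves.Fisher2012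

variable (c₄ c₆ : ℚ)

/-! ## §1 Partial derivatives of the quartic `𝔇` -/

/-- `∂λ/∂λ = 1` (private plumbing). [folklore] -/
private theorem pd0_X0 : pderiv 0 (X 0 : MvPolynomial (Fin 2) ℚ) = 1 := pderiv_X_self 0
/-- `∂μ/∂μ = 1` (private plumbing). [folklore] -/
private theorem pd1_X1 : pderiv 1 (X 1 : MvPolynomial (Fin 2) ℚ) = 1 := pderiv_X_self 1
/-- `∂μ/∂λ = 0` (private plumbing). [folklore] -/
private theorem pd0_X1 : pderiv 0 (X 1 : MvPolynomial (Fin 2) ℚ) = 0 := pderiv_X_of_ne (by decide)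
/-- `∂λ/∂μ = 0` (private plumbing). [folklore] -/
private theorem pd1_X0 : pderiv 1 (X 0 : MvPolynomial (Fin 2) ℚ) = 0 := pderiv_X_of_ne (by decide)

/-- `∂²𝔇/∂λ² = 12λ² − 12c₄μ²`. [cite: Fisher2012Hessian, §8 (n = 3)] -/
theorem pderiv_zero_zero_hesseD3 : pderiv 0 (pderiv 0 (hesseD3 c₄ c₆)) =
    C 12 * X 0 ^ 2 - C (12 * c₄) * X 1 ^ 2 := by
  rw [pderiv_zero_hesseD3]
  simp only [map_sub, pderiv_mul, pderiv_pow, pderiv_C, pd0_X0, pd0_X1,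
    mul_zero, zero_mul, add_zero, mul_one, sub_zero]
  simp only [map_mul, map_ofNat]
  push_cast
  ring

/-- `∂²𝔇/∂λ∂μ = −24c₄λμ − 24c₆μ²`. [cite: Fisher2012Hessian, §8 (n = 3)] -/
theorem pderiv_zero_one_hesseD3 : pderiv 0 (pderiv 1 (hesseD3 c₄ c₆)) =
    -(C (24 * c₄) * X 0 * X 1) - C (24 * c₆) * X 1 ^ 2 := by
  rw [pderiv_one_hesseD3]
  simp only [map_sub, map_neg, pderiv_mul, pderiv_pow, pderiv_C, pd0_X0, pd0_X1,
    mul_zero, zero_mul, add_zero, mul_one, sub_zero]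
  simp only [map_mul, map_ofNat]
  push_cast
  ring

/-- `∂²𝔇/∂μ² = −12c₄λ² − 48c₆λμ − 36c₄²μ²`. [cite: Fisher2012Hessian, §8 (n = 3)] -/
theorem pderiv_one_one_hesseD3 : pderiv 1 (pderiv 1 (hesseD3 c₄ c₆)) =
    -(C (12 * c₄) * X 0 ^ 2) - C (48 * c₆) * X 0 * X 1 - C (36 * c₄ ^ 2) * X 1 ^ 2 := by
  rw [pderiv_one_hesseD3]
  simp only [map_sub, map_neg, pderiv_mul, pderiv_pow, pderiv_C, pd1_X0, pd1_X1,
    mul_zero, zero_mul, add_zero, mul_one]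
  simp only [map_mul, map_pow, map_ofNat]
  push_cast
  ring

/-! ## §2 The covariants in closed form -/

/-- **`𝔠₄(λ,μ) = c₄λ⁴ + 4c₆λ³μ + 6c₄²λ²μ² + 4c₄c₆λμ³ + (4c₆² − 3c₄³)μ⁴`** — the closed form of
x11a's `hesseC4three = −|H(𝔇)|/(4²·3²)` (Salmon's quartic covariant). PROVED from the definition.
[cite: Fisher2012Hessian, §8 (display defining 𝔠₄, n = 3, deg 𝔇 = 4) and §1 (Salmon)] -/
theorem hesseC4three_eq : hesseC4three c₄ c₆ =
    C c₄ * X 0 ^ 4 + C (4 * c₆) * X 0 ^ 3 * X 1 + C (6 * c₄ ^ 2) * X 0 ^ 2 * X 1 ^ 2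
      + C (4 * c₄ * c₆) * X 0 * X 1 ^ 3 + C (4 * c₆ ^ 2 - 3 * c₄ ^ 3) * X 1 ^ 4 := by
  have h144 : hessianDet (hesseD3 c₄ c₆) = C (-144 : ℚ) *
      (C c₄ * X 0 ^ 4 + C (4 * c₆) * X 0 ^ 3 * X 1 + C (6 * c₄ ^ 2) * X 0 ^ 2 * X 1 ^ 2
        + C (4 * c₄ * c₆) * X 0 * X 1 ^ 3 + C (4 * c₆ ^ 2 - 3 * c₄ ^ 3) * X 1 ^ 4) := by
    rw [hessianDet, pderiv_zero_zero_hesseD3, pderiv_one_one_hesseD3, pderiv_zero_one_hesseD3]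
    simp only [map_mul, map_pow, map_sub, map_neg, map_ofNat]
    ring
  rw [hesseC4three, h144, ← mul_assoc, ← map_mul]
  norm_num

/-- `∂𝔠₄/∂λ = 4c₄λ³ + 12c₆λ²μ + 12c₄²λμ² + 4c₄c₆μ³`. [cite: Fisher2012Hessian, §8 (n = 3)] -/
theorem pderiv_zero_hesseC4three : pderiv 0 (hesseC4three c₄ c₆) =
    C (4 * c₄) * X 0 ^ 3 + C (12 * c₆) * X 0 ^ 2 * X 1 + C (12 * c₄ ^ 2) * X 0 * X 1 ^ 2
      + C (4 * c₄ * c₆) * X 1 ^ 3 := by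
  rw [hesseC4three_eq]
  simp only [map_add, pderiv_mul, pderiv_pow, pderiv_C, pd0_X0, pd0_X1,
    mul_zero, zero_mul, add_zero, mul_one, zero_add]
  simp only [map_mul, map_pow, map_ofNat]
  push_cast
  ring

/-- `∂𝔠₄/∂μ = 4c₆λ³ + 12c₄²λ²μ + 12c₄c₆λμ² + 4(4c₆² − 3c₄³)μ³`. [cite: Fisher2012Hessian, §8 (n = 3)] -/
theorem pderiv_one_hesseC4three : pderiv 1 (hesseC4three c₄ c₆) =
    C (4 * c₆) * X 0 ^ 3 + C (12 * c₄ ^ 2) * X 0 ^ 2 * X 1 + C (12 * c₄ * c₆) * X 0 * X 1 ^ 2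
      + C (4 * (4 * c₆ ^ 2 - 3 * c₄ ^ 3)) * X 1 ^ 3 := by
  rw [hesseC4three_eq]
  simp only [map_add, pderiv_mul, pderiv_pow, pderiv_C, pd1_X0, pd1_X1,
    mul_zero, zero_mul, add_zero, mul_one, zero_add]
  simp only [map_mul, map_pow, map_sub, map_ofNat]
  push_cast
  ring

/-- **`𝔠₆(λ,μ) = c₆λ⁶ + 6c₄²λ⁵μ + 15c₄c₆λ⁴μ² + 20c₆²λ³μ³ + 15c₄²c₆λ²μ⁴ + (18c₄⁴ − 12c₄c₆²)λμ⁵ + (9c₄³c₆ − 8c₆³)μ⁶`**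
— the closed form of x11a's `hesseC6three = |J(𝔇, 𝔠₄)|/(4·4)` (Salmon's sextic covariant). PROVED from
the definition. [cite: Fisher2012Hessian, §8 (display defining 𝔠₆, n = 3) and §1 (Salmon)] -/
theorem hesseC6three_eq : hesseC6three c₄ c₆ =
    C c₆ * X 0 ^ 6 + C (6 * c₄ ^ 2) * X 0 ^ 5 * X 1 + C (15 * c₄ * c₆) * X 0 ^ 4 * X 1 ^ 2
      + C (20 * c₆ ^ 2) * X 0 ^ 3 * X 1 ^ 3 + C (15 * c₄ ^ 2 * c₆) * X 0 ^ 2 * X 1 ^ 4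
      + C (18 * c₄ ^ 4 - 12 * c₄ * c₆ ^ 2) * X 0 * X 1 ^ 5 + C (9 * c₄ ^ 3 * c₆ - 8 * c₆ ^ 3) * X 1 ^ 6 := by
  have h16 : jacobianDet (hesseD3 c₄ c₆) (hesseC4three c₄ c₆) = C (16 : ℚ) *
      (C c₆ * X 0 ^ 6 + C (6 * c₄ ^ 2) * X 0 ^ 5 * X 1 + C (15 * c₄ * c₆) * X 0 ^ 4 * X 1 ^ 2
        + C (20 * c₆ ^ 2) * X 0 ^ 3 * X 1 ^ 3 + C (15 * c₄ ^ 2 * c₆) * X 0 ^ 2 * X 1 ^ 4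
        + C (18 * c₄ ^ 4 - 12 * c₄ * c₆ ^ 2) * X 0 * X 1 ^ 5
        + C (9 * c₄ ^ 3 * c₆ - 8 * c₆ ^ 3) * X 1 ^ 6) := by
    rw [jacobianDet, pderiv_zero_hesseD3, pderiv_one_hesseD3, pderiv_zero_hesseC4three,
      pderiv_one_hesseC4three]
    simp only [map_mul, map_pow, map_sub, map_ofNat]
    ring
  rw [hesseC6three, h16, ← mul_assoc, ← map_mul]
  norm_num

/-- **Fisher's relation `𝔠₄³ − 𝔠₆² = (c₄³ − c₆²)·𝔇³`** for `n = 3`, as an identity of polynomials.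
[cite: Fisher2012Hessian, §8 ("The Hesse polynomials are related by 𝔠₄(λ,μ)³ − 𝔠₆(λ,μ)² = (c₄³ − c₆²)𝔇(λ,μ)ⁿ")] -/
theorem hesseSyzygy_three :
    hesseC4three c₄ c₆ ^ 3 - hesseC6three c₄ c₆ ^ 2 = C (c₄ ^ 3 - c₆ ^ 2) * hesseD3 c₄ c₆ ^ 3 := by
  rw [hesseC4three_eq, hesseC6three_eq, hesseD3]
  simp only [map_mul, map_pow, map_sub, map_ofNat]
  ring

/-! ## §3 Evaluation at `(λ, μ) = (l, m)` and the pencil member in closed form -/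

/-- **The member `E_{l,m}` of the `n = 3` Hesse pencil in closed form**: `hessePencil3 c₄ c₆ l m` is the
short Weierstrass curve `⟨0, 0, 0, −27·𝔠₄(l,m), −54·𝔠₆(l,m)⟩` with the closed forms above — five rational
numbers, so "`G ≅_ℚ E_{l,m}`" is decidable by `norm_num`. [cite: Fisher2012Hessian, Thm. 13.2 (the family E_{λ,μ}, n = 3)] -/
theorem hessePencil3_eq (l m : ℚ) : hessePencil3 c₄ c₆ l m =
    ⟨0, 0, 0,
      -27 * (c₄ * l ^ 4 + 4 * c₆ * l ^ 3 * m + 6 * c₄ ^ 2 * l ^ 2 * m ^ 2 + 4 * c₄ * c₆ * l * m ^ 3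
        + (4 * c₆ ^ 2 - 3 * c₄ ^ 3) * m ^ 4),
      -54 * (c₆ * l ^ 6 + 6 * c₄ ^ 2 * l ^ 5 * m + 15 * c₄ * c₆ * l ^ 4 * m ^ 2 + 20 * c₆ ^ 2 * l ^ 3 * m ^ 3
        + 15 * c₄ ^ 2 * c₆ * l ^ 2 * m ^ 4 + (18 * c₄ ^ 4 - 12 * c₄ * c₆ ^ 2) * l * m ^ 5
        + (9 * c₄ ^ 3 * c₆ - 8 * c₆ ^ 3) * m ^ 6)⟩ := by
  rw [hessePencil3, eval_hesseC4three, eval_hesseC6three]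

/-- **`Δ(E_{l,m}) = 2⁶·3⁹·(c₄³ − c₆²)·𝔇(l,m)³`** (from `Δ(y² = x³ − 27A x − 54B) = 2⁶3⁹(A³ − B²)` and the
relation `𝔠₄³ − 𝔠₆² = (c₄³ − c₆²)𝔇³`). [cite: Fisher2012Hessian, §8 (relation, n = 3)]
[cite: SilvermanAEC2009, III §1] -/
theorem Δ_hessePencil3 (l m : ℚ) : (hessePencil3 c₄ c₆ l m).Δ =
    2 ^ 6 * 3 ^ 9 * (c₄ ^ 3 - c₆ ^ 2) * (MvPolynomial.eval ![l, m] (hesseD3 c₄ c₆)) ^ 3 := by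
  have h := congrArg (MvPolynomial.eval ![l, m]) (hesseSyzygy_three c₄ c₆)
  simp only [map_sub, map_mul, map_pow, eval_C] at h
  simp only [hessePencil3, WeierstrassCurve.Δ, WeierstrassCurve.b₂, WeierstrassCurve.b₄,
    WeierstrassCurve.b₆, WeierstrassCurve.b₈]
  linear_combination (2 ^ 6 * 3 ^ 9 : ℚ) * h

/-- `Δ` of Fisher's `E : y² = x³ − 27c₄x − 54c₆` is `2⁶·3⁹·(c₄³ − c₆²)`. [cite: SilvermanAEC2009, III §1] -/
theorem Δ_c4c6Model : (c4c6Model c₄ c₆).Δ = 2 ^ 6 * 3 ^ 9 * (c₄ ^ 3 - c₆ ^ 2) := by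
  simp only [c4c6Model, WeierstrassCurve.Δ, WeierstrassCurve.b₂, WeierstrassCurve.b₄,
    WeierstrassCurve.b₆, WeierstrassCurve.b₈]
  ring

/-- **Non-singular members ⟺ `𝔇(l,m) ≠ 0`**: when Fisher's `E` is an elliptic curve (`c₄³ ≠ c₆²`), the
member `E_{l,m}` is an elliptic curve iff `(l:m)` is not a cusp of `X_E(3)`, i.e. `𝔇(l,m) ≠ 0`.
[cite: Fisher2012Hessian, §8 (the roots of 𝔇 are the cusps) with Thm. 13.2 (n = 3)] -/
theorem isElliptic_hessePencil3_iff (l m : ℚ) [(c4c6Model c₄ c₆).IsElliptic] :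
    (hessePencil3 c₄ c₆ l m).IsElliptic ↔ MvPolynomial.eval ![l, m] (hesseD3 c₄ c₆) ≠ 0 := by
  have hE : (c4c6Model c₄ c₆).Δ ≠ 0 := (c4c6Model c₄ c₆).isUnit_Δ.ne_zero
  rw [Δ_c4c6Model] at hE
  rw [WeierstrassCurve.isElliptic_iff, Δ_hessePencil3, isUnit_iff_ne_zero]
  refine ⟨fun h hD => h ?_, fun hD => ?_⟩
  · rw [hD]; ring
  · exact mul_ne_zero hE (pow_ne_zero 3 hD)

/-- The member at a non-cusp is an elliptic curve (instance form of `isElliptic_hessePencil3_iff`, for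
certificates: supply `𝔇(l,m) ≠ 0` as a `Fact`). [cite: Fisher2012Hessian, Thm. 13.2 (n = 3)] -/
theorem isElliptic_hessePencil3_of_eval_hesseD3_ne_zero (l m : ℚ) [(c4c6Model c₄ c₆).IsElliptic]
    (hD : MvPolynomial.eval ![l, m] (hesseD3 c₄ c₆) ≠ 0) : (hessePencil3 c₄ c₆ l m).IsElliptic :=
  (isElliptic_hessePencil3_iff c₄ c₆ l m).mpr hD

end Literature.NumberTheory.EllipticCurves.Fisher2012

end
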